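import Summits.QuantumFields.GaugeBoot.FluctuationVanishing
import HarnessLib

/-!
# Fluctuations of Wilson loops, XIII: odd centered moments vanish (gauge-boot, ADDENDUM 32 part M)

HONEST FRAMING (cell `pub-gaugeboot`, page 1 of every file): the venture produces certified bounds
on lattice expectations at stated coupling, gauge group, dimension and torus size; NOT a mass gap,
NOT a continuum limit, NOT a string tension; NOT Yang–Mills-summit-bearing (barriers
`FixedCouplingUltralocality`, `PerturbativeInvisibility`).  Strong-coupling `SO(N)` lattice gauge theory with free boundary
condition (S. Chatterjee, Comm. Math. Phys. **366** (2019); S. Chatterjee, J. Jafarov, arXiv:1604.04777); nothing about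
four-dimensional continuum Yang–Mills or a mass gap.

## Content

`centered_coeff_odd_vanish`: in the setting of `centered_coeff_vanish` (power-series centered block products
`G(B₀; C₁, …, C_m)` of the `1/N` coefficient series, `|β|` below the contraction threshold), the LEADING coefficient
`coeff_m G(B₀; C₁, …, C_m)` vanishes whenever the number `m ≤ K` of centered blocks is ODD.  Proof: by
`centered_coeff_vanish` every term of the order-`m` coefficient equation (`centered_equation_coeff`) with fewer than the
maximal order for its number of blocks drops out; what is left is the homogeneous first-order-in-`β` block equation
for `coeff_m G` on `m`-block states, sourced only by `F₂(M) · coeff_{m-2} G(B₀; m − 2 blocks)` from the cross mergers of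
two centered blocks — which vanishes by induction (`m − 2` odd) — so `block_contraction` forces `coeff_m G = 0`.  This is
the combinatorial shadow of Wick's rule: an odd number of centered Wilson loops cannot be paired up.

Everything here is `[new (lane)]` over the cited expansion.
-/

noncomputable section

open Finset Filter Topology PowerSeries
open Literature.MathematicalPhysics.QuantumFieldTheory.Chatterjee2019LargeN
open Literature.MathematicalPhysics.QuantumFieldTheory.Chatterjee2019LargeN.Word

namespace Summit.QuantumFields.GaugeBoot

namespace StringDuality

variable {d : ℕ}

/-- ★★ Odd centered moments vanish at leading order: for `m ≤ K` odd, genuine `B₀` and genuine centered blocks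
`C₁, …, C_m`, `coeff_m G(B₀; C₁, …, C_m) = 0`. [new (lane)] -/
theorem centered_coeff_odd_vanish {β : ℝ} {K : ℕ} {F : ℕ → ℝ → LoopSeq d → ℝ} {Cc Lc : ℝ} (hCc : 1 ≤ Cc) (hLc : 1 ≤ Lc)
    (hF0 : ∀ u : LoopSeq d, F 0 β u = 0) (hF1 : ∀ u : LoopSeq d, F 1 β u = 0)
    (hrec : ∀ k, k ≤ K → ∀ s : LoopSeq d, IsLoopSeq s → s ≠ [] →
      (s.len : ℝ) * F (k + 2) β s -
          ((∑ o : InvIdx s, F (k + 2) β (s.negSplitAt o)) - (∑ o : SameIdx s, F (k + 2) β (s.posSplitAt o))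
            + β * (∑ o : DeformIdx s, F (k + 2) β (s.negDeformAt o))
            - β * (∑ o : DeformIdx s, F (k + 2) β (s.posDeformAt o))) =
        (s.len : ℝ) * F (k + 1) β s
          + ((∑ o : SameIdx s, F (k + 1) β (s.negTwistAt o)) - ∑ o : InvIdx s, F (k + 1) β (s.posTwistAt o))
          + ((∑ o : MergeIdx s, F k β (s.negMergeAt o)) - ∑ o : MergeIdx s, F k β (s.posMergeAt o)))
    (hperm : ∀ k, k ≤ K → ∀ s s' : LoopSeq d, IsLoopSeq s → s.Perm s' → F (k + 2) β s = F (k + 2) β s')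
    (hnil : ∀ k, k ≤ K → F (k + 2) β [] = if k = 0 then 1 else 0)
    (hbd : ∀ j, j ≤ K → ∀ u : LoopSeq d, IsLoopSeq u → |F (j + 2) β u| ≤ Cc * Lc ^ u.len)
    (hβ : |β| ≤ 1 / (4096 * ((d : ℝ) + 1) * (((1 + (K + 1) * Cc) * Lc) ^ 2 + 4) ^ 4))
    (P : LoopSeq d → PowerSeries ℝ) (hP : ∀ (u : LoopSeq d) (k : ℕ), coeff k (P u) = F (k + 2) β u)
    {G : LoopSeq d → List (LoopSeq d) → PowerSeries ℝ} (hG0 : ∀ B₀ : LoopSeq d, G B₀ [] = P B₀)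
    (hGs : ∀ (B₀ C : LoopSeq d) (rest : List (LoopSeq d)), G B₀ (C :: rest) = G (B₀ ++ C) rest - P C * G B₀ rest) :
    ∀ m, m ≤ K → Odd m → ∀ (B₀ : LoopSeq d) (Cs : List (LoopSeq d)), IsLoopSeq B₀ → (∀ C ∈ Cs, IsLoopSeq C) →
      Cs.length = m → coeff m (G B₀ Cs) = 0 := by
  -- ### the real block operators
  obtain ⟨SD, hSD⟩ : ∃ SD : LoopSeq d → (LoopSeq d → ℝ) → ℝ, ∀ A g, SD A g =
      ((∑ o : InvIdx A, g (A.negSplitAt o)) - ∑ o : SameIdx A, g (A.posSplitAt o))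
        + β * ((∑ o : DeformIdx A, g (A.negDeformAt o)) - ∑ o : DeformIdx A, g (A.posDeformAt o)) := ⟨fun A g => _, fun _ _ => rfl⟩
  obtain ⟨TW, hTW⟩ : ∃ TW : LoopSeq d → (LoopSeq d → ℝ) → ℝ, ∀ A g, TW A g =
      (∑ o : SameIdx A, g (A.negTwistAt o)) - ∑ o : InvIdx A, g (A.posTwistAt o) := ⟨fun A g => _, fun _ _ => rfl⟩
  obtain ⟨ME, hME⟩ : ∃ ME : LoopSeq d → (LoopSeq d → ℝ) → ℝ, ∀ A g, ME A g =
      (∑ o : MergeIdx A, g (A.negMergeAt o)) - ∑ o : MergeIdx A, g (A.posMergeAt o) := ⟨fun A g => _, fun _ _ => rfl⟩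
  obtain ⟨XM, hXM⟩ : ∃ XM : LoopSeq d → LoopSeq d → (LoopSeq d → ℝ) → ℝ, ∀ A B g, XM A B g =
      (∑ i : Fin A.length, ∑ j : Fin B.length,
          ∑ q : {xy : Fin (A.get i).length × Fin (B.get j).length // ((B.get j).get xy.2).1 = ((A.get i).get xy.1).1},
            (g (A.take i ++ LoopSeq.prune [Word.negMerge _ q.1.1 _ q.1.2] ++ A.drop (i + 1) ++ B.eraseIdx j)
              - g (A.take i ++ LoopSeq.prune [Word.posMerge _ q.1.1 _ q.1.2] ++ A.drop (i + 1) ++ B.eraseIdx j)))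
      + ∑ j : Fin B.length, ∑ i : Fin A.length,
          ∑ q : {xy : Fin (B.get j).length × Fin (A.get i).length // ((A.get i).get xy.2).1 = ((B.get j).get xy.1).1},
            (g (A.eraseIdx i ++ (B.take j ++ LoopSeq.prune [Word.negMerge _ q.1.1 _ q.1.2] ++ B.drop (j + 1)))
              - g (A.eraseIdx i ++ (B.take j ++ LoopSeq.prune [Word.posMerge _ q.1.1 _ q.1.2] ++ B.drop (j + 1)))) :=
    ⟨fun A B g => _, fun _ _ _ => rfl⟩
  have SD0 : ∀ A, SD A (fun _ => 0) = 0 := fun A => by rw [hSD]; simp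
  have TW0 : ∀ A, TW A (fun _ => 0) = 0 := fun A => by rw [hTW]; simp
  have ME0 : ∀ A, ME A (fun _ => 0) = 0 := fun A => by rw [hME]; simp
  have XM0 : ∀ A B, XM A B (fun _ => 0) = 0 := fun A B => by rw [hXM]; simp
  -- ### vanishing below the number of blocks
  have hvan := centered_coeff_vanish hCc hLc hF0 hF1 hrec hperm hnil hbd hβ P hP hG0 hGs
  -- ### empty blocks kill all coefficients up to order `K`
  have hnilG : ∀ (Cs : List (LoopSeq d)), [] ∈ Cs → ∀ (B₀ : LoopSeq d), ∀ k, k ≤ K → coeff k (G B₀ Cs) = 0 := by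
    intro Cs
    induction Cs with
    | nil => intro h; simp at h
    | cons C rest ih =>
      intro hmem B₀ k hk
      rw [hGs, map_sub, PowerSeries.coeff_mul]
      by_cases hC : C = []
      · subst hC
        rw [List.append_nil, Finset.sum_eq_single (0, k)]
        · rw [hP, hnil 0 (Nat.zero_le K), if_pos rfl, one_mul, sub_self]
        · intro q hq hne
          have hq' : q.1 + q.2 = k := Finset.HasAntidiagonal.mem_antidiagonal.mp hq
          have hq1 : q.1 ≠ 0 := fun h => hne (by ext <;> simp <;> omega)
          rw [hP, hnil q.1 (by omega), if_neg hq1, zero_mul]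
        · intro h; exact absurd (Finset.HasAntidiagonal.mem_antidiagonal.mpr (by simp)) h
      · have hrest : [] ∈ rest := by
          rcases List.mem_cons.mp hmem with h | h
          · exact absurd h.symm hC
          · exact h
        rw [ih hrest (B₀ ++ C) k hk, Finset.sum_eq_zero fun q hq => ?_, sub_zero]
        have hq' : q.1 + q.2 = k := Finset.HasAntidiagonal.mem_antidiagonal.mp hq
        rw [ih hrest B₀ q.2 (by omega), mul_zero]
  -- ### the a priori bound
  set D : ℝ := 1 + (K + 1) * Cc with hD
  have hD1 : 1 ≤ D := by rw [hD]; nlinarith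
  have hbdP : ∀ j, j ≤ K → ∀ u : LoopSeq d, IsLoopSeq u → |coeff j (P u)| ≤ Cc * Lc ^ u.len := by
    intro j hj u hu; rw [hP]; exact hbd j hj u hu
  have apriori := centered_coeff_bound hCc hLc hbdP hG0 hGs
  -- ### induction on the (odd) number of blocks
  intro m
  induction m using Nat.strong_induction_on with
  | _ m ih =>
  intro hm hodd
  have hodd' : m % 2 = 1 := Nat.odd_iff.mp hodd
  -- the unknown family: the order-`m` coefficient on `m`-block states
  set u : LoopSeq d → List (LoopSeq d) → ℝ := fun B₀ Cs => if Cs.length = m then coeff m (G B₀ Cs) else 0 with hu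
  have hzero := block_contraction (d := d) (β := β) (Mb := Cc) (Lb := D * Lc) (by linarith) (by nlinarith) hβ SD hSD u
    ?_ ?_ ?_ ?_
  · intro B₀ Cs hB₀ hCs hlen
    have h := hzero B₀ Cs hB₀ hCs
    simp only [hu, if_pos hlen] at h
    exact h
  · -- a priori bound
    intro B₀ Cs hB₀ hCs
    simp only [hu]
    split_ifs with hlen
    · by_cases hmem : [] ∈ Cs
      · rw [hnilG Cs hmem B₀ m hm, abs_zero]; positivity
      have hCs' : ∀ C ∈ Cs, IsLoopSeq C ∧ C ≠ [] := fun C hC => ⟨hCs C hC, fun h => hmem (h ▸ hC)⟩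
      refine (apriori Cs hCs B₀ hB₀ m hm).trans ?_
      have hml := length_le_sum_len Cs hCs'
      rw [LoopSeq.len_append, len_flatten, mul_pow, mul_assoc]
      refine mul_le_mul_of_nonneg_left ?_ (by linarith)
      calc D ^ Cs.length * Lc ^ (B₀.len + (Cs.map LoopSeq.len).sum)
          ≤ D ^ (B₀.len + (Cs.map LoopSeq.len).sum) * Lc ^ (B₀.len + (Cs.map LoopSeq.len).sum) :=
            mul_le_mul_of_nonneg_right (pow_le_pow_right₀ hD1 (by omega)) (by positivity)
        _ = _ := rfl
    · rw [abs_zero]; positivity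
  · -- empty blocks
    intro B₀ Cs hmem
    simp only [hu]
    split_ifs
    · exact hnilG Cs hmem B₀ m hm
    · rfl
  · -- no blocks at all: `m` is odd, hence nonzero
    simp only [hu, List.length_nil]
    rw [if_neg]
    omega
  · -- the homogeneous equation
    intro B₀ Cs hB₀ hCs' hflat
    have hCs : ∀ C ∈ Cs, IsLoopSeq C := fun C hC => (hCs' C hC).1
    by_cases hlen : Cs.length = m
    · -- the real coefficient equation at order `m`
      have E := centered_equation_coeff hF0 hF1 hrec hperm P hP hG0 hGs SD TW ME XM hSD hTW hME hXM m hm Cs hCs' B₀ hB₀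
      -- its right side vanishes: lower orders by `centered_coeff_vanish`, the pair source by induction
      have R1 : (if m = 0 then (0 : ℝ) else
          (((B₀.len + (Cs.map LoopSeq.len).sum : ℕ) : ℝ) * coeff (m - 1) (G B₀ Cs) + TW B₀ (fun A => coeff (m - 1) (G A Cs))
            + ∑ j : Fin Cs.length, TW (Cs.get j) (fun C' => coeff (m - 1) (G B₀ (Cs.set j C'))))) = 0 := by
        split_ifs with hm0
        · rfl
        rw [hvan (m - 1) (by omega) B₀ Cs hB₀ hCs (by omega), mul_zero, zero_add,
          TW_congr_gen TW hTW hB₀ (g' := fun _ => 0) (fun A hA => hvan (m - 1) (by omega) A Cs hA hCs (by omega)), TW0,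
          zero_add]
        refine Finset.sum_eq_zero fun j _ => ?_
        rw [TW_congr_gen TW hTW (hCs _ (List.get_mem Cs j)) (g' := fun _ => 0) (fun C' hC' =>
          hvan (m - 1) (by omega) B₀ _ hB₀ (forall_mem_set hCs hC' j) (by rw [List.length_set]; omega)), TW0]
      have R2 : (if m < 2 then (0 : ℝ) else
          (ME B₀ (fun A => coeff (m - 2) (G A Cs))
            + (∑ j : Fin Cs.length, ME (Cs.get j) (fun C' => coeff (m - 2) (G B₀ (Cs.set j C'))))
            + (∑ j : Fin Cs.length, XM B₀ (Cs.get j) (fun M => coeff (m - 2) (G M (Cs.eraseIdx j))))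
            + ∑ j : Fin Cs.length, ∑ j' : Fin Cs.length, if (j : ℕ) < j' then
                XM (Cs.get j) (Cs.get j') (fun M => coeff (m - 2) (G B₀ ((Cs.set j M).eraseIdx j'))
                  + ∑ q ∈ antidiagonal (m - 2), F (q.1 + 2) β M * coeff q.2 (G B₀ ((Cs.eraseIdx j').eraseIdx j)))
              else 0)) = 0 := by
        split_ifs with hm2
        · rfl
        have t1 : ME B₀ (fun A => coeff (m - 2) (G A Cs)) = 0 := by
          rw [ME_congr_gen ME hME hB₀ (g' := fun _ => 0) (fun A hA => hvan (m - 2) (by omega) A Cs hA hCs (by omega)), ME0]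
        have t2 : (∑ j : Fin Cs.length, ME (Cs.get j) (fun C' => coeff (m - 2) (G B₀ (Cs.set j C')))) = 0 :=
          Finset.sum_eq_zero fun j _ => by
            rw [ME_congr_gen ME hME (hCs _ (List.get_mem Cs j)) (g' := fun _ => 0) (fun C' hC' =>
              hvan (m - 2) (by omega) B₀ _ hB₀ (forall_mem_set hCs hC' j) (by rw [List.length_set]; omega)), ME0]
        have t3 : (∑ j : Fin Cs.length, XM B₀ (Cs.get j) (fun M => coeff (m - 2) (G M (Cs.eraseIdx j)))) = 0 :=
          Finset.sum_eq_zero fun j _ => by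
            rw [XM_congr_gen XM hXM hB₀ (hCs _ (List.get_mem Cs j)) (g' := fun _ => 0) (fun M hM =>
              hvan (m - 2) (by omega) M _ hM (forall_mem_eraseIdx hCs j)
                (by rw [List.length_eraseIdx_of_lt j.isLt]; omega)), XM0]
        have t4 : (∑ j : Fin Cs.length, ∑ j' : Fin Cs.length, if (j : ℕ) < j' then
            XM (Cs.get j) (Cs.get j') (fun M => coeff (m - 2) (G B₀ ((Cs.set j M).eraseIdx j'))
              + ∑ q ∈ antidiagonal (m - 2), F (q.1 + 2) β M * coeff q.2 (G B₀ ((Cs.eraseIdx j').eraseIdx j)))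
            else 0) = 0 := by
          refine Finset.sum_eq_zero fun j _ => Finset.sum_eq_zero fun j' _ => ?_
          split_ifs with hjj
          · rw [XM_congr_gen XM hXM (hCs _ (List.get_mem Cs j)) (hCs _ (List.get_mem Cs j')) (g' := fun _ => 0)
              (fun M hM => ?_), XM0]
            have hj' := j'.isLt
            have hlen2 : ((Cs.eraseIdx j').eraseIdx j).length = m - 2 := by
              rw [List.length_eraseIdx_of_lt (by rw [List.length_eraseIdx_of_lt hj']; omega),
                List.length_eraseIdx_of_lt hj']; omega
            rw [hvan (m - 2) (by omega) B₀ _ hB₀ (forall_mem_eraseIdx (forall_mem_set hCs hM j) j')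
              (by rw [List.length_eraseIdx_of_lt (by rw [List.length_set]; exact hj'), List.length_set]; omega), zero_add]
            refine Finset.sum_eq_zero fun q hq => ?_
            have hq' : q.1 + q.2 = m - 2 := Finset.HasAntidiagonal.mem_antidiagonal.mp hq
            rcases Nat.lt_or_ge q.2 (m - 2) with hql | hqg
            · rw [hvan q.2 (by omega) B₀ _ hB₀ (forall_mem_eraseIdx (forall_mem_eraseIdx hCs j') j) (by rw [hlen2]; omega),
                mul_zero]
            · have hq2 : q.2 = m - 2 := by omega
              rw [hq2, ih (m - 2) (by omega) (by omega) (Nat.odd_iff.mpr (by omega)) B₀ _ hB₀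
                (forall_mem_eraseIdx (forall_mem_eraseIdx hCs j') j) hlen2, mul_zero]
          · rfl
        rw [t1, t2, t3, t4]; ring
      rw [R1, R2, add_zero] at E
      -- the left side is the `u`-equation
      have e0 : u B₀ Cs = coeff m (G B₀ Cs) := by simp only [hu, if_pos hlen]
      have e1 : (fun A => u A Cs) = fun A => coeff m (G A Cs) := by funext A; simp only [hu, if_pos hlen]
      have e2 : ∀ j : Fin Cs.length, (fun C' => u B₀ (Cs.set j C')) = fun C' => coeff m (G B₀ (Cs.set j C')) := by
        intro j; funext C'; simp only [hu, List.length_set, if_pos hlen]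
      rw [e0, e1, Finset.sum_congr rfl fun j _ => by rw [e2 j], LoopSeq.len_append, len_flatten]
      exact E
    · -- another number of blocks: everything is zero
      have e0 : u B₀ Cs = 0 := by simp only [hu, if_neg hlen]
      have e1 : (fun A => u A Cs) = fun _ => 0 := by funext A; simp only [hu, if_neg hlen]
      have e2 : ∀ j : Fin Cs.length, (fun C' => u B₀ (Cs.set j C')) = fun _ => 0 := by
        intro j; funext C'; simp only [hu, List.length_set, if_neg hlen]
      rw [e0, e1, Finset.sum_congr rfl fun j _ => by rw [e2 j], SD0, Finset.sum_congr rfl fun j _ => SD0 _]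
      simp

end StringDuality

end Summit.QuantumFields.GaugeBoot

end
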